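import Mathlib
import Summits.Ventures.FusionMHD.Models.CerfonFreidbergIterLikeQHalfResDefs
import HarnessLib

/-!
# Ventures/FusionMHD — Models/CerfonFreidbergIterLikeQHalfResPanels9.lean: KERNEL CHECK of the resistive-register certificates of panel(s) 14, 15 (of 32)
# at `ψ_N = 1/2` of THE Cerfon–Freidberg ITER-like instance

HONEST FRAMING (LADDER-GRIDFUSION three columns; CF rung; rider «D_R at ψ_N = 1/2»).  One `decide +kernel` (≈ 60–90 s): for each listed panel the obligation
`CFIterLike.QHalfRes.ResCert.ok` (`Models/CerfonFreidbergIterLikeQHalfResDefs.lean`) — the Taylor-model run of `progR = progM ++ block3R` over ★ #117's parameter box is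
ACCEPTED and the kernel's two panel-integral enclosures (`g_AG`, `g_W` along the approximant) lie inside the claimed integers (compiled `#eval` of the same functions, slack
one unit of `2⁻⁶⁰`; float truth inside every panel, `genqm/truthR.json`).  MODELLED: analytic Cerfon–Freidberg family; nothing about a device or stability.
No `native_decide`.  Typer/prover: gridfusion-model-7 (g7), 2026-08-28.  Citations: Zheng 2015 §3.2 (3.42) [Zheng2015];
Mahboubi–Melquiond–Sibut-Pinote 2016 §3.2 Lemma 3 [MahboubiMelquiondSibutpinote2016].
-/

namespace Summit.Ventures.FusionMHD.Models.CFIterLike.QHalfRes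

/-- Resistive-register certificate data of panel(s) 14, 15. [instance data] -/
def resCert9 : List ResCert := [
  { j := 14, cand1 := [552442246874651951104, 5298541242292801372160, 34114803959202697969664, 146720158803837505765376, 286909467647060329103360, -1638340804391549284646912, -20706203589769295713796096, -119734608979638507716739072, -390394662404755867836612608, 81500829089550979454468096, 4995393135965434927504162816, 58756331196329910735860662272, 7074315136866487487986032181248],
    cand2 := [467769854292252819456, 4459741215559989592064, 33947842933381899747328, 191547694957808842702848, 728370761877868236505088, 427512697106639452372992, -22041271924297106829869056, -236278802523519771731820544, -1566597225291867057433870336, -7155829018170705852374188032, -20657629197724980549062230016, 91701497905617579634080088064, 8170348067051336631571496042496],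
    deg := 10, e1 := 44, e2 := 44, glo := 5162436089245772, ghi := 5162436607281913, wlo := 329666800987527290, whi := 329666829401505289 },
  { j := 15, cand1 := [756016123241661988864, 7883201681001134686208, 48670233196155570749440, 149351767544392641937408, -423224223601512337637376, -8517055133192140953223168, -53955699459799820321947648, -144098086128004147192004608, 639478656953182747017347072, 9578539874764844894680776704, 49943444497343618332154134528, 92501386106842351610072399872, 1813879664420299125183903432704],
    cand2 := [646812855879759953920, 7227699221795436494848, 55791784441645677674496, 262227228897044215103488, 87337199820181612789760, -12108434213203227782938624, -134488185882155158610116608, -840798775613957792507887616, -2342655242634886018173501440, 16384545675239161159443546112, 286254284111746129443229270016, 2263940159058267571054270480384, 12772619369132006456250150682624],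
    deg := 10, e1 := 44, e2 := 44, glo := 4934162018149733, ghi := 4934162408906008, wlo := 367218084981559543, whi := 367218108949012566 }]

/-- **KERNEL CHECK** of the two resistive registers on panel(s) 14, 15. -/
theorem resCert9_ok : CFIterLike.QHalfRes.resCert9.all ResCert.ok = true := by
  decide +kernel

end Summit.Ventures.FusionMHD.Models.CFIterLike.QHalfRes
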